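import Summits.ValiantsHypothesis.ValiantsHypothesis.Theorems.KPlusLogSqLawValuativeDoorGenTwoSidon
import Summits.ValiantsHypothesis.ValiantsHypothesis.Theorems.KPlusLogSqLawValuativeDoorNewtonPolygon

/-!
# LINE `valuative_door` (crux `WeakLifting`, stmt-ValiantsHypothesis-19561) — the width-two Sidon rows IN ROOT-RADIUS LANGUAGE:
# a split symmetric (resp. general) `2 × 2` Sidon pencil determinant with `K` letters has at most `3K − 4` (resp. `5K − 11`) distinct
# root absolute values

HONEST FRAMING.  Helper (cell `pub-symmetroid`, seat val-sym-lift-p1 g23, 2026-08-29; `--supports 19561 --as helper`).  Corollaries only: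
the rows `…SidonTwo.valSidonTwo_unfolded` (`npEdges ≤ 3K − 4`) and `…GenTwoSidon.valGenSidonTwo_unfolded` (`npEdges ≤ 5K − 11`, `K ≥ 4`)
read through the Newton-polygon dictionary `…NewtonPolygon.domCount_of_splits` (`npEdges` = number of distinct absolute values of the roots
of a split polynomial not vanishing at `0`): `card_rootRadii_le_of_sidon_two`, `card_rootRadii_le_of_sidon_two_gen`.  Calibration in the
line's root currency; no bearing on vW / vB, `TropicalB`, `MatrixDescartes` (18050) or VP ≠ VNP.  [corollaries]
-/

set_option linter.dupNamespace false
set_option autoImplicit false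

namespace Summit.ValiantsHypothesis.ValiantsHypothesis.Theorems.KPlusLogSqLaw.ValDoor

open Polynomial Finset Matrix
open scoped BigOperators Classical

/-- **SYMMETRIC WIDTH-TWO SIDON ROW, ROOT FORM:** over a field of characteristic zero with a non-archimedean absolute value `v`, if the
determinant of a symmetric `2 × 2` lacunary pencil with `K` letters on a Sidon support splits and does not vanish at `0`, its roots take at
most `3K − 4` distinct absolute values. [`valSidonTwo_unfolded` + `domCount_of_splits`] -/
theorem card_rootRadii_le_of_sidon_two (F : Type) [Field F] [CharZero F] (v : AbsoluteValue F ℝ) (hv : IsNonarchimedean v)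
    (K : ℕ) (d : Fin K → ℕ) (S : Fin K → Matrix (Fin 2) (Fin 2) F) (hS : ∀ l, (S l).IsSymm)
    (hsid : ∀ l₁ l₂ l₃ l₄ : Fin K, d l₁ + d l₂ = d l₃ + d l₄ → (l₁ = l₃ ∧ l₂ = l₄) ∨ (l₁ = l₄ ∧ l₂ = l₃))
    (hsplit : (Matrix.det (∑ l, ((Polynomial.X : Polynomial F) ^ d l) • (S l).map Polynomial.C)).Splits)
    (h0 : (Matrix.det (∑ l, ((Polynomial.X : Polynomial F) ^ d l) • (S l).map Polynomial.C)).eval 0 ≠ 0) :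
    (((Matrix.det (∑ l, ((Polynomial.X : Polynomial F) ^ d l) • (S l).map Polynomial.C)).roots.map v).toFinset).card
      ≤ 3 * K - 4 := by
  have h1 := valSidonTwo_unfolded F v hv K d S hS hsid
  have h2 := domCount_of_splits v hv _ hsplit h0
  rw [h2] at h1
  simpa using h1

/-- **GENERAL WIDTH-TWO SIDON ROW, ROOT FORM:** the same for ARBITRARY `2 × 2` letters with `K ≥ 4`: at most `5K − 11` distinct root
absolute values. [`valGenSidonTwo_unfolded` + `domCount_of_splits`] -/
theorem card_rootRadii_le_of_sidon_two_gen (F : Type) [Field F] [CharZero F] (v : AbsoluteValue F ℝ) (hv : IsNonarchimedean v)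
    (K : ℕ) (hK : 4 ≤ K) (d : Fin K → ℕ) (M : Fin K → Matrix (Fin 2) (Fin 2) F)
    (hsid : ∀ l₁ l₂ l₃ l₄ : Fin K, d l₁ + d l₂ = d l₃ + d l₄ → (l₁ = l₃ ∧ l₂ = l₄) ∨ (l₁ = l₄ ∧ l₂ = l₃))
    (hsplit : (Matrix.det (∑ l, ((Polynomial.X : Polynomial F) ^ d l) • (M l).map Polynomial.C)).Splits)
    (h0 : (Matrix.det (∑ l, ((Polynomial.X : Polynomial F) ^ d l) • (M l).map Polynomial.C)).eval 0 ≠ 0) :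
    (((Matrix.det (∑ l, ((Polynomial.X : Polynomial F) ^ d l) • (M l).map Polynomial.C)).roots.map v).toFinset).card
      ≤ 5 * K - 11 := by
  have h1 := valGenSidonTwo_unfolded F v hv K hK d M hsid
  have h2 := domCount_of_splits v hv _ hsplit h0
  rw [h2] at h1
  simpa using h1

end Summit.ValiantsHypothesis.ValiantsHypothesis.Theorems.KPlusLogSqLaw.ValDoor
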